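import Literature.AlgebraicTopology.Homotopy.CubeHomotopyExtension
import Literature.AlgebraicTopology.Homotopy.GenLoopPaths
import Literature.AlgebraicTopology.Homotopy.WeakHomotopyEquivalence
import Literature.AlgebraicTopology.Homotopy.RelativeHomotopyGroups
import HarnessLib

/-!
# Lifting cubes rel boundary through a map, up to homotopy (the core of Whitehead's theorem)

Topic `Literature/AlgebraicTopology/Homotopy`. Step 4/6 of the proof of the named fact
`Literature.AlgebraicTopology.Homotopy.whitehead_exists_homotopyEquiv_of_isWeakHomotopyEquiv` (Hatcher, *Algebraic Topology*
(2002), Thm. 4.5; Miller 2020, Thm. 46.9). The relative lifting property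

* `Literature.AlgebraicTopology.Homotopy.CubeLift.LiftsRel f K B` — for every `ξ : K → X` continuous on `B ⊆ K` and every
  `c : K → Y` with `c|B = f ∘ ξ|B` there is `Ξ : K → X` with `Ξ|B = ξ|B` and `f ∘ Ξ ≃ c rel B`

(the property by which `n`-connected maps are characterised; for `(K, B) = (Dⁿ, ∂Dⁿ)` it is
`CWLift.BallLift` of `CWHomotopyLifting.lean`, and for pairs of spaces it is the compression
criterion of Hatcher, p. 343, with Thm. 4.3, p. 344) is established here for the cylinder
`(I × Iᴹ, ∂(I × Iᴹ))`, and
transported to the cube `(Iᴺ, ∂Iᴺ)`, from two hypotheses on `f` at the level of generalized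
loops (`CubeLift.liftsRel_cylinder`, `CubeLift.liftsRel_cube`):

* (inj) `f ∘ -` is injective on homotopy classes rel `∂Iᴹ` of generalized loops `Ω^M X x`, at
  every base point (injectivity of `f_*` on `π_M`);
* (surj) every map `d : I × Iᴹ → Y` constant `= f x` on `∂(I × Iᴹ)` is homotopic rel
  `∂(I × Iᴹ)` to `f ∘ e` for some `e : I × Iᴹ → X` constant `= x` on the boundary (surjectivity
  of `f_*` on `π_{M⁺}` in cylinder form).

Both hold for a weak homotopy equivalence (planned sibling file `WeakEquivalenceLifts.lean`). All
declarations are PROVED; no named facts.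

Related, and deliberately different in scope: `RelativeCompression.lean` proves the compression
lemma for a PAIR `(X, A)` on simplices `(Δ^{q+1}, ∂Δ^{q+1})` from the vanishing of the tree's
relative homotopy groups `RelHomotopyGroup` (pointed sets), for the Eilenberg deformation of
singular simplices; the present file is about a MAP `f : X → Y` (no subspace, no relative
groups), on cubes, with hypotheses on the absolute groups only, which is what Whitehead's
theorem for a weak homotopy equivalence consumes (`CWLift.BallLift` via `WeakEquivalenceLifts`).

## Proof (`liftsRel_cylinder`; Hatcher's compression criterion p. 343 and Lemma 4.6 p. 346 + the
## long exact sequence of homotopy groups of Thm. 4.3 p. 344, unwound in the cube model)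

Given `ξ` on `∂(I × Iᴹ)` and `c` with `c|∂ = f ∘ ξ`:
1. *Normalisation.* The part `J = {1} × Iᴹ ∪ I × ∂Iᴹ` of the boundary contracts in itself to
   the corner `(1, 1…1)` (`jContract`); composing with `ξ` and extending over the bottom face by
   the HEP of `(Iᴹ, ∂Iᴹ)` gives a homotopy `η` of `ξ` on the whole boundary to boundary data
   `ξ₁` which is constant `= x₀` on `J`; the HEP of the cylinder moves `c` along `f ∘ η` to `c₁`.
2. *Normalised problem = path algebra* (`exists_lift_normalized`). Now `ξ₁` is a generalized loop
   `b ∈ Ω^M X x₀` on the bottom face and `x₀` on `J`, and `c₁` is a path of slices from `f ∘ b`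
   to the constant loop in `Ω^M Y (f x₀)` (`GenLoopPaths.lean`). By (inj), `b` is null-homotopic
   rel `∂Iᴹ`: a path `B₀` from `b` to `const` in `Ω^M X x₀`. The loop `(f ∘ B₀)⁻¹ · c₁` at the
   constant loop of `Ω^M Y (f x₀)` is, by (surj), homotopic to `f ∘ ê` for a loop `ê` in
   `Ω^M X x₀`; then `B = B₀ · ê` satisfies `f ∘ B ≃ (f ∘ B₀) · (f ∘ B₀)⁻¹ · c₁ ≃ c₁` rel endpoints
   (groupoid laws of `Path.Homotopy`), and uncurrying `B` gives the lift `Ξ₁`.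
3. *Transport back.* The HEP of the cylinder moves `Ξ₁` along `η` reversed to an extension `Ξ` of
   the original `ξ`; the free homotopy `f ∘ Ξ ≃ f ∘ Ξ₁ ≃ c₁ ≃ c` has boundary track
   `(f ∘ η)⁻¹ · const · (f ∘ η)`, so `f ∘ Ξ ≃ c` rel the boundary
   (`CubeHEP.homotopicRel_of_homotopies`, transported to the cylinder).

## References

* A. Hatcher, *Algebraic Topology*, CUP (2002), §4.1, pp. 343–346 (relative homotopy groups,
  compression criterion, Thm. 4.3), Lemma 4.6. [HatcherAT2002]
-/

noncomputable section

open Set unitInterval Function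
open scoped Topology Topology.Homotopy unitInterval

namespace Literature.AlgebraicTopology.Homotopy

namespace CubeLift

open GenLoopPath

variable {X Y Z : Type*} [TopologicalSpace X] [TopologicalSpace Y] [TopologicalSpace Z]

/-! ### The relative lifting property and its invariance under homeomorphisms of pairs -/

/-- **`f` lifts `(K, B)` rel `B` up to homotopy**: for every `ξ : K → X` continuous on `B` and
every `c : K → Y` (continuous) with `c = f ∘ ξ` on `B`, there is a continuous `Ξ : K → X` with
`Ξ = ξ` on `B` and `f ∘ Ξ ≃ c` rel `B` (the relative lifting property characterising
`n`-connected maps for `(K, B) = (Dⁿ, ∂Dⁿ)`; cf. `CWLift.BallLift`). As there, `ξ` is a TOTAL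
function `K → X` of which only the values on `B` matter; consequently for `X = ∅` (and `K ≠ ∅`)
the property holds vacuously even when `B = ∅` — it is intended for nonempty `X`, as in all uses
(`isWeakHomotopyEquiv_of_liftsRel` assumes `Nonempty X`). [folklore] -/
def LiftsRel (f : C(X, Y)) (K : Type*) [TopologicalSpace K] (B : Set K) : Prop :=
  ∀ (ξ : K → X) (c : C(K, Y)), ContinuousOn ξ B → (∀ p ∈ B, c p = f (ξ p)) →
    ∃ Ξ : C(K, X), (∀ p ∈ B, Ξ p = ξ p) ∧ (f.comp Ξ).HomotopicRel c B

section Transport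

variable {K K' : Type*} [TopologicalSpace K] [TopologicalSpace K']

/-- Precomposing a homotopy rel `B` with a map sending `B'` into `B` gives a homotopy rel `B'`.
Statement-identical local copy of `ContinuousMap.HomotopyRel.compContinuousMapOfMapsTo` of
`Literature/AlgebraicTopology/SingularHomology/HurewiczSimplexClass.lean`, kept here so that the
Whitehead-theorem chain does not import the singular-homology simplex files; librarian hoist
request (shared light file, these become aliases): event 306026. [folklore] -/
def homotopyRelPrecomp {u v : C(K, Z)} {B : Set K} (H : u.HomotopyRel v B) (g : C(K', K))
    {B' : Set K'} (hg : MapsTo g B' B) : (u.comp g).HomotopyRel (v.comp g) B' where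
  toFun q := H (q.1, g q.2)
  continuous_toFun := by fun_prop
  map_zero_left q := by simp
  map_one_left q := by simp
  prop' t q hq := by
    show H (t, g q) = u (g q)
    exact H.eq_fst t (hg hq)

/-- `HomotopicRel` version of `homotopyRelPrecomp`; statement-identical local copy of
`ContinuousMap.HomotopicRel.comp_continuousMap_of_mapsTo` (`HurewiczSimplexClass.lean`), see the
hoist request event 306026. [folklore] -/
theorem homotopicRel_precomp {u v : C(K, Z)} {B : Set K} (h : u.HomotopicRel v B) (g : C(K', K))
    {B' : Set K'} (hg : MapsTo g B' B) : (u.comp g).HomotopicRel (v.comp g) B' :=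
  h.map fun H => homotopyRelPrecomp H g hg

/-- A homotopy rel `B'` between `u ∘ e` and `v ∘ e`, for a homeomorphism `e` matching `B'` with
`B`, gives a homotopy rel `B` between `u` and `v`. [folklore] -/
theorem homotopicRel_of_precomp_homeomorph {u v : C(K, Z)} {B : Set K} {B' : Set K'} (e : K' ≃ₜ K)
    (he : ∀ p, p ∈ B' ↔ e p ∈ B)
    (h : (u.comp (e : C(K', K))).HomotopicRel (v.comp (e : C(K', K))) B') : u.HomotopicRel v B := by
  have hg : MapsTo (e.symm : C(K, K')) B B' := fun p hp => (he _).2 (by simpa using hp)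
  have h' := homotopicRel_precomp h (e.symm : C(K, K')) hg
  have hu : (u.comp (e : C(K', K))).comp (e.symm : C(K, K')) = u := by ext p; simp
  have hv : (v.comp (e : C(K', K))).comp (e.symm : C(K, K')) = v := by ext p; simp
  rwa [hu, hv] at h'

/-- **`LiftsRel` is invariant under homeomorphisms of pairs.** [folklore] -/
theorem LiftsRel.of_homeomorph {f : C(X, Y)} {B : Set K} {B' : Set K'} (h : LiftsRel f K B)
    (e : K' ≃ₜ K) (he : ∀ p, p ∈ B' ↔ e p ∈ B) : LiftsRel f K' B' := by
  intro ξ' c' hξ' hc'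
  have hmaps : MapsTo (e.symm : K → K') B B' := fun p hp => (he _).2 (by simpa using hp)
  have hξ : ContinuousOn (fun p => ξ' (e.symm p)) B :=
    hξ'.comp e.symm.continuous.continuousOn hmaps
  obtain ⟨Ξ, hΞ, hH⟩ := h (fun p => ξ' (e.symm p)) (c'.comp (e.symm : C(K, K'))) hξ
    (fun p hp => by simpa using hc' (e.symm p) (hmaps hp))
  refine ⟨Ξ.comp (e : C(K', K)), fun p hp => ?_, ?_⟩
  · have := hΞ (e p) ((he p).1 hp)
    simpa using this
  · have h1 := homotopicRel_precomp hH (e : C(K', K)) (fun p hp => (he p).1 hp)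
    have hc : (c'.comp (e.symm : C(K, K'))).comp (e : C(K', K)) = c' := by ext p; simp
    rw [hc] at h1
    exact h1

end Transport

/-! ### The cylinder `I × Iᴹ` as the cube `I^{Option M}`; free homotopies on the cylinder -/

section Cylinder

variable {M : Type*}

variable (M) in
/-- The cube on `Option M` is the cylinder over the cube on `M`:
`I^{Option M} ≃ₜ I × Iᴹ`, `z ↦ (z none, z ∘ some)`. [folklore] -/
def cubeOptionHomeo : (Option M → I) ≃ₜ I × (M → I) where
  toFun z := (z none, fun i => z (some i))
  invFun p o := Option.elim o p.1 p.2
  left_inv z := by funext o; cases o <;> rfl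
  right_inv _ := rfl
  continuous_toFun := (continuous_apply none).prodMk (continuous_pi fun i => continuous_apply _)
  continuous_invFun := continuous_pi fun o => by
    cases o
    · exact continuous_fst
    · exact (continuous_apply _).comp continuous_snd

/-- `cubeOptionHomeo` matches the boundary of the cube with the boundary of the cylinder.
[folklore] -/
theorem mem_boundary_iff_cubeOptionHomeo (z : Option M → I) :
    z ∈ Cube.boundary (Option M) ↔ cubeOptionHomeo M z ∈ cylBd M := by
  constructor
  · rintro ⟨o, ho⟩
    cases o with
    | none => rcases ho with h | h <;> [exact Or.inl h; exact Or.inr (Or.inl h)]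
    | some i => exact Or.inr (Or.inr ⟨i, ho⟩)
  · rintro (h | h | ⟨i, hi⟩)
    · exact ⟨none, Or.inl h⟩
    · exact ⟨none, Or.inr h⟩
    · exact ⟨some i, hi⟩

/-- **Three homotopies with a common boundary track, on the cylinder**: the cylinder version of
`CubeHEP.homotopicRel_of_homotopies` (transport along `cubeOptionHomeo`). If `A : w₁ ≃ u`,
`G : w₁ ≃ w₂ rel ∂(I × Iᴹ)`, `C : w₂ ≃ v`, and `A = C` on `I × ∂(I × Iᴹ)`, then
`u ≃ v rel ∂(I × Iᴹ)`. [cite: HatcherAT2002, §4.1 p. 341] -/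
theorem homotopicRel_of_homotopies_cyl [Fintype M] {u v w₁ w₂ : C(I × (M → I), Z)}
    (A : w₁.Homotopy u) (G : w₁.HomotopyRel w₂ (cylBd M)) (C : w₂.Homotopy v)
    (hAC : ∀ (s : I), ∀ p ∈ cylBd M, A (s, p) = C (s, p)) : u.HomotopicRel v (cylBd M) := by
  set Φ : C(Option M → I, I × (M → I)) := (cubeOptionHomeo M : C(Option M → I, I × (M → I)))
  have hΦ : MapsTo Φ (Cube.boundary (Option M)) (cylBd M) :=
    fun z hz => (mem_boundary_iff_cubeOptionHomeo z).1 hz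
  have h := CubeHEP.homotopicRel_of_homotopies (A.compContinuousMap Φ)
    (homotopyRelPrecomp G Φ hΦ) (C.compContinuousMap Φ)
    (fun s z hz => hAC s (Φ z) (hΦ hz))
  exact homotopicRel_of_precomp_homeomorph (cubeOptionHomeo M) mem_boundary_iff_cubeOptionHomeo h

end Cylinder

/-! ### Normalisation: contracting `J` and moving boundary data to data constant on `J` -/

section Normalize

variable {M : Type*}

variable (M) in
/-- **A contraction of `J` in itself** (and of the whole cylinder) to the corner `(1, 1…1)`:
first push everything vertically onto the top face (`t ↦ t + 2s(1 - t)` for `s ≤ 1/2`), then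
contract the top face linearly to its corner (`s ≥ 1/2`). Walls stay in walls and the top face
in the top face, so `J` is preserved. [folklore] -/
def jContract : C(I × (I × (M → I)), I × (M → I)) where
  toFun q := if (q.1 : ℝ) ≤ 2⁻¹ then
      (Set.projIcc 0 1 zero_le_one ((q.2.1 : ℝ) + 2 * q.1 * (1 - q.2.1)), q.2.2)
    else (1, fun i => Set.projIcc 0 1 zero_le_one ((q.2.2 i : ℝ) + (2 * q.1 - 1) * (1 - q.2.2 i)))
  continuous_toFun := by
    refine continuous_if_le (by fun_prop) continuous_const ?_ ?_ ?_
    · exact ((continuous_projIcc.comp (by fun_prop)).prodMk (by fun_prop)).continuousOn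
    · exact (continuous_const.prodMk
        (continuous_pi fun i => continuous_projIcc.comp (by fun_prop))).continuousOn
    · rintro ⟨s, t, y⟩ hs
      simp only at hs
      have h1 : (t : ℝ) + 2 * s * (1 - t) = 1 := by rw [hs]; ring
      ext
      · simp [h1]
      · simp [hs]

/-- At `s = 0`, `jContract` is the identity. [folklore] -/
theorem jContract_zero (p : I × (M → I)) : jContract M (0, p) = p := by
  obtain ⟨t, y⟩ := p
  have h : ((0 : I) : ℝ) ≤ 2⁻¹ := by norm_num
  simp only [jContract, ContinuousMap.coe_mk, h, if_true]
  ext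
  · simp
  · rfl

/-- At `s = 1`, `jContract` is the constant map to the corner `(1, 1…1)`. [folklore] -/
theorem jContract_one (p : I × (M → I)) : jContract M (1, p) = (1, fun _ => 1) := by
  obtain ⟨t, y⟩ := p
  have h : ¬ ((1 : I) : ℝ) ≤ 2⁻¹ := by norm_num
  simp only [jContract, ContinuousMap.coe_mk, h, if_false]
  refine Prod.ext rfl (funext fun i => ?_)
  have h1 : (1 : ℝ) ≤ (y i : ℝ) + (2 * ((1 : I) : ℝ) - 1) * (1 - (y i : ℝ)) := by norm_num
  change Set.projIcc 0 1 zero_le_one ((y i : ℝ) + (2 * ((1 : I) : ℝ) - 1) * (1 - (y i : ℝ))) = 1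
  rw [Set.projIcc_of_right_le _ h1]
  rfl

/-- `jContract` preserves `J`. [folklore] -/
theorem jContract_mem_jSet (s : I) {p : I × (M → I)} (hp : p ∈ jSet M) :
    jContract M (s, p) ∈ jSet M := by
  obtain ⟨t, y⟩ := p
  by_cases hs : (s : ℝ) ≤ 2⁻¹
  · simp only [jContract, ContinuousMap.coe_mk, hs, if_true]
    rcases hp with ht | hy
    · left
      dsimp only at ht ⊢
      subst ht
      apply Subtype.ext
      simp
    · exact Or.inr hy
  · simp only [jContract, ContinuousMap.coe_mk, hs, if_false]
    exact Or.inl rfl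

/-- `J` is closed (for `M` finite). [folklore] -/
theorem isClosed_jSet [Finite M] : IsClosed (jSet M) :=
  (isClosed_eq continuous_fst continuous_const).union
    (CubeHEP.isClosed_cubeBoundary.preimage continuous_snd)

/-- The boundary of the cylinder is the bottom face together with `J`. [folklore] -/
theorem cylBd_eq_union : cylBd M = {p : I × (M → I) | p.1 = 0} ∪ jSet M := by
  ext p
  simp only [mem_cylBd, mem_union, mem_setOf_eq, mem_jSet]

/-- **Normalising boundary data.** Boundary data `ξ` (continuous on `∂(I × Iᴹ)`) is homotopic,
through boundary data, to data constant `= ξ (1, 1…1)` on `J`: `η` is continuous on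
`I × ∂(I × Iᴹ)`, starts at `ξ` and ends at such data (on `J` it is `ξ ∘ jContract`, on the
bottom face the homotopy extension of `ξ ∘ jContract|∂Iᴹ`). [folklore] -/
theorem exists_normalization [Fintype M] (ξ : I × (M → I) → X) (hξ : ContinuousOn ξ (cylBd M)) :
    ∃ η : I × (I × (M → I)) → X, ContinuousOn η (univ ×ˢ cylBd M) ∧
      (∀ p ∈ cylBd M, η (0, p) = ξ p) ∧ (∀ p ∈ jSet M, η (1, p) = ξ (1, fun _ => 1)) := by
  classical
  -- the bottom face and the homotopy of its boundary
  have hbot : ∀ y : M → I, ((0 : I), y) ∈ cylBd M := fun y => Or.inl rfl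
  let φ : C(M → I, X) := ⟨fun y => ξ (0, y), hξ.comp_continuous (by fun_prop) hbot⟩
  let h : I × (M → I) → X := fun q => ξ (jContract M (q.1, (0, q.2)))
  have hjc : Continuous fun q : I × (M → I) => jContract M (q.1, (0, q.2)) := by fun_prop
  have hh : ContinuousOn h (univ ×ˢ Cube.boundary M) := by
    refine hξ.comp hjc.continuousOn ?_
    rintro ⟨s, y⟩ ⟨-, hy⟩
    exact jSet_subset_cylBd (jContract_mem_jSet s (Or.inr hy))
  have h0 : ∀ y ∈ Cube.boundary M, h (0, y) = φ y := fun y _ => by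
    show ξ (jContract M (0, (0, y))) = ξ (0, y)
    rw [jContract_zero]
  obtain ⟨Θ, hΘ0, hΘb⟩ := CubeHEP.exists_extension_cube φ h hh h0
  -- the homotopy of the boundary data
  refine ⟨fun q => if q.2.1 = 0 then Θ (q.1, q.2.2) else ξ (jContract M (q.1, q.2)), ?_, ?_, ?_⟩
  · -- continuity on `I × (bottom ∪ J)`
    rw [cylBd_eq_union, prod_union]
    refine ContinuousOn.union_of_isClosed ?_ ?_
      (isClosed_univ.prod (isClosed_eq continuous_fst continuous_const))
      (isClosed_univ.prod isClosed_jSet)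
    · refine (Θ.continuous.comp (continuous_fst.prodMk
        (continuous_snd.comp continuous_snd))).continuousOn.congr ?_
      rintro ⟨s, t, y⟩ ⟨-, ht⟩
      simp only [mem_setOf_eq] at ht
      simp [ht]
    · have hc : ContinuousOn (fun q : I × (I × (M → I)) => ξ (jContract M (q.1, q.2)))
          (univ ×ˢ jSet M) := by
        refine hξ.comp (by fun_prop : Continuous fun q : I × (I × (M → I)) =>
          jContract M (q.1, q.2)).continuousOn ?_
        rintro ⟨s, p⟩ ⟨-, hp⟩
        exact jSet_subset_cylBd (jContract_mem_jSet s hp)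
      refine hc.congr ?_
      rintro ⟨s, t, y⟩ ⟨-, hp⟩
      by_cases ht : t = 0
      · subst ht
        have hy : y ∈ Cube.boundary M := by
          rcases hp with h1 | hy
          · exact absurd h1 (by simp)
          · exact hy
        simp only [if_true]
        show Θ (s, y) = ξ (jContract M (s, (0, y)))
        rw [hΘb s y hy]
      · simp only [ht, if_false]
  · rintro ⟨t, y⟩ hp
    by_cases ht : t = 0
    · subst ht
      simp only [if_true]
      exact hΘ0 y
    · simp only [ht, if_false]
      rw [jContract_zero]
  · rintro ⟨t, y⟩ hp
    by_cases ht : t = 0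
    · subst ht
      have hy : y ∈ Cube.boundary M := by
        rcases hp with h1 | hy
        · exact absurd h1 (by simp)
        · exact hy
      simp only [if_true]
      rw [hΘb 1 y hy]
      show ξ (jContract M (1, (0, y))) = _
      rw [jContract_one]
    · simp only [ht, if_false]
      rw [jContract_one]

end Normalize

/-! ### The normalised problem: path algebra in `Ω^M X x₀ → Ω^M Y (f x₀)` -/

section Core

variable {M : Type*} (f : C(X, Y))

/-- `f ∘ -` on generalized loops is continuous. [folklore] -/
theorem continuous_genLoopMap (x : X) : Continuous (genLoopMap (N := M) f x) :=
  ((ContinuousMap.continuous_postcomp f).comp continuous_subtype_val).subtype_mk _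

/-- `f ∘ const = const`. [folklore] -/
theorem genLoopMap_const (x : X) : genLoopMap (N := M) f x GenLoop.const = GenLoop.const := by
  ext; rfl

/-- **The normalised lifting problem.** Let `b ∈ Ω^M X x₀` and let `c₁ : I × Iᴹ → Y` be
constant `= f x₀` on `J` with bottom face `f ∘ b` (a null-homotopy rel `∂Iᴹ` of `f ∘ b`).
If `f ∘ -` is injective on homotopy classes of `Ω^M X x₀` (inj) and every map of the cylinder
constant `= f x₀` on its boundary lifts rel boundary up to homotopy (surj), then there is
`Ξ₁ : I × Iᴹ → X`, constant `= x₀` on `J` with bottom face `b`, such that `f ∘ Ξ₁ ≃ c₁` rel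
`∂(I × Iᴹ)`. Proof: path algebra in `Ω^M X x₀ → Ω^M Y (f x₀)` (module docstring, step 2).
[cite: HatcherAT2002, §4.1 Thm. 4.3 and p. 346] -/
theorem exists_lift_normalized (x₀ : X)
    (Hinj : ∀ p q : Ω^ M X x₀, GenLoop.Homotopic (genLoopMap f x₀ p) (genLoopMap f x₀ q) →
      GenLoop.Homotopic p q)
    (Hsurj : ∀ d : C(I × (M → I), Y), (∀ p ∈ cylBd M, d p = f x₀) →
      ∃ e : C(I × (M → I), X), (∀ p ∈ cylBd M, e p = x₀) ∧ (f.comp e).HomotopicRel d (cylBd M))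
    (b : Ω^ M X x₀) (c₁ : C(I × (M → I), Y)) (hcJ : ∀ p ∈ jSet M, c₁ p = f x₀)
    (hcb : ∀ y, c₁ (0, y) = f (b y)) :
    ∃ Ξ₁ : C(I × (M → I), X), (∀ p ∈ jSet M, Ξ₁ p = x₀) ∧ (∀ y, Ξ₁ (0, y) = b y) ∧
      (f.comp Ξ₁).HomotopicRel c₁ (cylBd M) := by
  -- notation: `F = f ∘ -` on `Ω^M`
  set F : Ω^ M X x₀ → Ω^ M Y (f x₀) := genLoopMap f x₀ with hFdef
  have hF : Continuous F := continuous_genLoopMap f x₀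
  have hFconst : F GenLoop.const = GenLoop.const := genLoopMap_const f x₀
  -- the path of slices of `c₁`, recast to start at `F b` and end at `F const`
  have hface : F b = slice c₁ hcJ 0 := by
    ext y
    exact (hcb y).symm
  let ĉ : Path (F b) (F GenLoop.const) := (toPath c₁ hcJ).cast hface hFconst
  -- (b) `b` is null-homotopic rel `∂Iᴹ`, by (inj)
  have hbnull : GenLoop.Homotopic b GenLoop.const := by
    apply Hinj
    rw [hFconst]
    exact (genLoop_homotopic_iff_joined _ _).2 ⟨ĉ.cast rfl hFconst.symm⟩
  obtain ⟨B₀⟩ : Joined b GenLoop.const := (genLoop_homotopic_iff_joined _ _).1 hbnull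
  -- (c) the loop `δ = (F B₀)⁻¹ · ĉ` at `F const`, realised on the cylinder
  let β : Path (F b) (F GenLoop.const) := B₀.map hF
  let δ : Path (F GenLoop.const) (F GenLoop.const) := β.symm.trans ĉ
  let d : C(I × (M → I), Y) := ofPath δ
  have hdJ : ∀ p ∈ jSet M, d p = f x₀ := by
    rintro ⟨t, y⟩ (ht | hy)
    · dsimp only at ht
      subst ht
      show δ 1 y = f x₀
      rw [δ.target]
      rfl
    · exact ofPath_apply_of_mem_boundary δ t hy
  have hd : ∀ p ∈ cylBd M, d p = f x₀ := by
    rintro ⟨t, y⟩ (ht | hJ)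
    · dsimp only at ht
      subst ht
      show δ 0 y = f x₀
      rw [δ.source]
      rfl
    · exact hdJ _ hJ
  -- (d) lift `d` by (surj)
  obtain ⟨e, heB, hed⟩ := Hsurj d hd
  have heJ : ∀ p ∈ jSet M, e p = x₀ := fun p hp => heB p (jSet_subset_cylBd hp)
  have hslice : (GenLoop.const : Ω^ M X x₀) = slice e heJ 0 := by
    ext y
    exact (heB (0, y) (Or.inl rfl)).symm
  let ê : Path (GenLoop.const : Ω^ M X x₀) GenLoop.const := (toPath e heJ).cast hslice rfl
  have hfeJ : ∀ p ∈ jSet M, (f.comp e) p = f x₀ := fun p hp => by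
    show f (e p) = f x₀
    rw [heJ p hp]
  have h1 := homotopicRel_toPath hfeJ hdJ hed
  have e1 : (toPath (f.comp e) hfeJ : C(I, Ω^ M Y (f x₀))) = (ê.map hF : C(I, Ω^ M Y (f x₀))) := by
    ext t y
    rfl
  have e2 : (toPath d hdJ : C(I, Ω^ M Y (f x₀))) = (δ : C(I, Ω^ M Y (f x₀))) := by
    ext t y
    rfl
  have hê : (ê.map hF).Homotopic δ := by
    rw [path_homotopic_iff_homotopicRel, ← e1, ← e2]
    exact h1
  -- (e) the corrected null-homotopy `B = B₀ · ê` and `F B ≃ ĉ`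
  let B : Path b GenLoop.const := B₀.trans ê
  have hB : (B.map hF).Homotopic ĉ := by
    rw [Path.map_trans]
    refine Path.Homotopic.trans (Path.Homotopic.hcomp (Path.Homotopic.refl β) hê) ?_
    refine Path.Homotopic.trans ⟨(Path.Homotopy.transAssoc β β.symm ĉ).symm⟩ ?_
    refine Path.Homotopic.trans (Path.Homotopic.hcomp ⟨(Path.Homotopy.reflTransSymm β).symm⟩
      (Path.Homotopic.refl ĉ)) ?_
    exact ⟨Path.Homotopy.reflTrans ĉ⟩
  -- (f) uncurry `B`
  have hΞJ : ∀ p ∈ jSet M, ofPath B p = x₀ := ofPath_jSet B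
  have hfΞJ : ∀ p ∈ jSet M, (f.comp (ofPath B)) p = f x₀ := fun p hp => by
    show f (ofPath B p) = f x₀
    rw [hΞJ p hp]
  refine ⟨ofPath B, hΞJ, fun y => by simp [B], ?_⟩
  refine homotopicRel_of_toPath hfΞJ hcJ ?_
  have e3 : (toPath (f.comp (ofPath B)) hfΞJ : C(I, Ω^ M Y (f x₀))) =
      (B.map hF : C(I, Ω^ M Y (f x₀))) := by
    ext t y
    rfl
  have e4 : (toPath c₁ hcJ : C(I, Ω^ M Y (f x₀))) = (ĉ : C(I, Ω^ M Y (f x₀))) := by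
    ext t y
    rfl
  rw [e3, e4]
  exact (path_homotopic_iff_homotopicRel _ _).1 hB

end Core

/-! ### Lifting the cylinder and the cube rel boundary -/

section Main

variable {M : Type*} [Fintype M] (f : C(X, Y))

/-- **`f` lifts the cylinder `(I × Iᴹ, ∂(I × Iᴹ))` rel boundary up to homotopy**, GIVEN (inj)
injectivity of `f ∘ -` on homotopy classes rel `∂Iᴹ` of generalized loops at every base point
and (surj) liftability of maps of the cylinder constant on the boundary (module docstring).
[cite: HatcherAT2002, §4.1 Lemma 4.6 and p. 346] -/
theorem liftsRel_cylinder
    (Hinj : ∀ (x : X) (p q : Ω^ M X x),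
      GenLoop.Homotopic (genLoopMap f x p) (genLoopMap f x q) → GenLoop.Homotopic p q)
    (Hsurj : ∀ (x : X) (d : C(I × (M → I), Y)), (∀ p ∈ cylBd M, d p = f x) →
      ∃ e : C(I × (M → I), X), (∀ p ∈ cylBd M, e p = x) ∧ (f.comp e).HomotopicRel d (cylBd M)) :
    LiftsRel f (I × (M → I)) (cylBd M) := by
  intro ξ c hξ hc
  -- 1. normalise the boundary data
  obtain ⟨η, hη, hη0, hη1⟩ := exists_normalization ξ hξ
  set x₀ : X := ξ (1, fun _ => 1) with hx₀
  have hfη : ContinuousOn (fun q => f (η q)) (univ ×ˢ cylBd M) := f.continuous.comp_continuousOn hη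
  obtain ⟨Cm, hC0, hCb⟩ := CubeHEP.exists_extension_cylinder c (fun q => f (η q)) hfη
    (fun p hp => by show f (η (0, p)) = c p; rw [hη0 p hp, hc p hp])
  let c₁ : C(I × (M → I), Y) := ⟨fun p => Cm (1, p), by fun_prop⟩
  have hbcont : Continuous fun y : M → I => η (1, ((0 : I), y)) :=
    hη.comp_continuous (by fun_prop) fun y => ⟨mem_univ _, Or.inl rfl⟩
  have hbJ : ∀ y ∈ Cube.boundary M, η (1, ((0 : I), y)) = x₀ :=
    fun y hy => hη1 (0, y) (Or.inr hy)
  let b : Ω^ M X x₀ := ⟨⟨fun y => η (1, ((0 : I), y)), hbcont⟩, hbJ⟩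
  have hcJ : ∀ p ∈ jSet M, c₁ p = f x₀ := fun p hp => by
    show Cm (1, p) = f x₀
    rw [hCb 1 p (jSet_subset_cylBd hp), hη1 p hp]
  have hcb : ∀ y, c₁ (0, y) = f (b y) := fun y => by
    show Cm (1, (0, y)) = f (η (1, (0, y)))
    exact hCb 1 (0, y) (Or.inl rfl)
  -- 2. solve the normalised problem
  obtain ⟨Ξ₁, hΞJ, hΞb, hΞc⟩ := exists_lift_normalized f x₀ (Hinj x₀) (Hsurj x₀) b c₁ hcJ hcb
  -- 3. transport back along `η` reversed
  have hηr : ContinuousOn (fun q : I × (I × (M → I)) => η (σ q.1, q.2)) (univ ×ˢ cylBd M) :=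
    hη.comp (by fun_prop : Continuous fun q : I × (I × (M → I)) => (σ q.1, q.2)).continuousOn
      fun q hq => ⟨mem_univ _, hq.2⟩
  have hΞ₁η : ∀ p ∈ cylBd M, η (σ 0, p) = Ξ₁ p := by
    rintro ⟨t, y⟩ hp
    rw [symm_zero]
    rcases hp with ht | hJ
    · dsimp only at ht
      subst ht
      exact (hΞb y).symm
    · rw [hη1 _ hJ, hΞJ _ hJ]
  obtain ⟨E, hE0, hEb⟩ := CubeHEP.exists_extension_cylinder Ξ₁ (fun q => η (σ q.1, q.2)) hηr hΞ₁η
  let Ξ : C(I × (M → I), X) := ⟨fun p => E (1, p), by fun_prop⟩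
  refine ⟨Ξ, fun p hp => ?_, ?_⟩
  · show E (1, p) = ξ p
    rw [hEb 1 p hp, symm_one, hη0 p hp]
  · -- the three homotopies `f ∘ E` (reversed in the lemma), `hΞc`, `Cm`
    let EH : Ξ₁.Homotopy Ξ :=
      { toFun := E
        continuous_toFun := E.continuous
        map_zero_left := hE0
        map_one_left := fun _ => rfl }
    let CH : c.Homotopy c₁ :=
      { toFun := Cm
        continuous_toFun := Cm.continuous
        map_zero_left := hC0
        map_one_left := fun _ => rfl }
    obtain ⟨G⟩ := hΞc
    refine homotopicRel_of_homotopies_cyl ((ContinuousMap.Homotopy.refl f).comp EH) G CH.symm ?_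
    intro s p hp
    show f (E (s, p)) = Cm (σ s, p)
    rw [hEb s p hp, hCb (σ s) p hp]

variable {N : Type*} [DecidableEq N]

/-- `Cube.insertAt i` matches the boundary of the cylinder over `I^{N ∖ i}` with `∂Iᴺ`: the pair
form of `RelGenLoop.insertAt_mem_boundary_iff` (`RelativeHomotopyGroups.lean`), of which this is a
one-line alias (`cylBd` is definitionally the disjunction there). [folklore] -/
theorem insertAt_mem_boundary_iff (i : N) (p : I × ({j // j ≠ i} → I)) :
    Cube.insertAt i p ∈ Cube.boundary N ↔ p ∈ cylBd {j // j ≠ i} :=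
  RelGenLoop.insertAt_mem_boundary_iff i p.1 p.2

/-- **`f` lifts the cube `(Iᴺ, ∂Iᴺ)` rel boundary up to homotopy** (`N` finite, nonempty via
`i : N`), GIVEN (inj) and (surj) for the index type `{j // j ≠ i}`: transport of
`liftsRel_cylinder` along `Cube.splitAt i : Iᴺ ≃ₜ I × I^{N ∖ i}`.
[cite: HatcherAT2002, §4.1 Lemma 4.6 and p. 346] -/
theorem liftsRel_cube [Fintype N] (i : N)
    (Hinj : ∀ (x : X) (p q : Ω^ {j // j ≠ i} X x),
      GenLoop.Homotopic (genLoopMap f x p) (genLoopMap f x q) → GenLoop.Homotopic p q)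
    (Hsurj : ∀ (x : X) (d : C(I × ({j // j ≠ i} → I), Y)), (∀ p ∈ cylBd {j // j ≠ i}, d p = f x) →
      ∃ e : C(I × ({j // j ≠ i} → I), X), (∀ p ∈ cylBd {j // j ≠ i}, e p = x) ∧
        (f.comp e).HomotopicRel d (cylBd {j // j ≠ i})) :
    LiftsRel f (N → I) (Cube.boundary N) := by
  refine (liftsRel_cylinder f Hinj Hsurj).of_homeomorph (Cube.splitAt i) fun z => ?_
  have h := insertAt_mem_boundary_iff i (Cube.splitAt i z)
  rw [show Cube.insertAt i (Cube.splitAt i z) = z from (Cube.splitAt i).symm_apply_apply z] at h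
  exact h

end Main

end CubeLift

end Literature.AlgebraicTopology.Homotopy

end
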